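import Literature.Geometry.Symplectic.SelfDualTripleRotation
import Literature.Geometry.Symplectic.HondaModelNearSymplectic
import HarnessLib

/-!
# The forms `Σ aₖ βₖ`, their Pfaffian, and quadratic estimates for the Pfaffian

Topic `Geometry/Symplectic`; namespace `Literature.Geometry.Symplectic`.  One definition
(`betaForm`) and proved lemmas; no named fact, no `sorry`.  `betaForm a = a₀β₁ + a₁β₂ + a₂β₃`
packages the linear combinations of Honda's forms `βₖ` that carry the `1`-jet of a
near-symplectic form along a zero circle (`ZeroCircleAdaptedChart`) and Honda's model
`ω_A = betaForm (D x)`, `D = diag(1, 1, -2)` (`hondaFormCLM_eq_betaForm`).  Its Pfaffian is the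
sum of squares `Pf(betaForm a) = Σ aₖ²` (`pfaffian_betaForm`: the `βₖ` are wedge-orthonormal).
For the gluing estimates we record the polarisation identity
`Pf(α + β) = Pf α + ⟨α, β⟩ + Pf β` with the crude bounds `|⟨α, β⟩| ≤ 6‖α‖‖β‖`, `|Pf β| ≤ 3‖β‖²`
(`abs_pfaffianPair_le`, `abs_pfaffian_le`), hence
`Pf(α + β) ≥ Pf α - 6‖α‖‖β‖ - 3‖β‖²` (`pfaffian_add_ge`), and `‖betaForm a‖ ≤ B Σ |aₖ|`.

## References

* T. Perutz, *Zero-sets of near-symplectic forms*, J. Symplectic Geom. 4 (2006), §2 eq. (1)–(2)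
  and §3 (proof of Lemma 3.1). [Perutz2006]
-/

noncomputable section

open scoped Matrix
open Set Function Module Matrix Literature.Geometry.Kaehler

namespace Literature.Geometry.Symplectic

/-! ### The forms `Σ aₖ βₖ` -/

/-- **`betaForm a = a₀ β₁ + a₁ β₂ + a₂ β₃`.** [cite: Perutz2006, §2 eq. (1)] -/
def betaForm (a : Fin 3 → ℝ) : (EuclideanSpace ℝ (Fin 4)) [⋀^Fin 2]→L[ℝ] ℝ :=
  a 0 • hondaBeta₁ + a 1 • hondaBeta₂ + a 2 • hondaBeta₃

/-- Values of `betaForm a`. [folklore] -/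
@[simp] theorem betaForm_apply (a : Fin 3 → ℝ) (U V : EuclideanSpace ℝ (Fin 4)) :
    betaForm a ![U, V] = ∑ k, a k * hondaBetaVec U V k := by
  simp [betaForm, hondaBetaVec, Fin.sum_univ_three]

/-- `betaForm` is additive. [folklore] -/
theorem betaForm_add (a b : Fin 3 → ℝ) : betaForm (a + b) = betaForm a + betaForm b := by
  simp only [betaForm, Pi.add_apply, add_smul]; abel

/-- `betaForm` is homogeneous. [folklore] -/
theorem betaForm_smul (c : ℝ) (a : Fin 3 → ℝ) : betaForm (c • a) = c • betaForm a := by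
  simp only [betaForm, Pi.smul_apply, smul_eq_mul, mul_smul, smul_add]

/-- `betaForm` is subtractive. [folklore] -/
theorem betaForm_sub (a b : Fin 3 → ℝ) : betaForm (a - b) = betaForm a - betaForm b := by
  have h := betaForm_add (a - b) b
  rw [sub_add_cancel] at h
  rw [h, add_sub_cancel_right]

/-- `betaForm 0 = 0`. [folklore] -/
@[simp] theorem betaForm_zero : betaForm 0 = 0 := by simp [betaForm]

/-- **`Pf(Σ aₖ βₖ) = Σ aₖ²`**: the `βₖ` are wedge-orthonormal. [cite: Perutz2006, §2 eq. (2)] -/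
theorem pfaffian_betaForm (a : Fin 3 → ℝ) : pfaffian (betaForm a) = ∑ k, a k ^ 2 := by
  simp [pfaffian, stdVec, hondaBetaVec, Fin.sum_univ_three]
  ring

/-- **Honda's model is `betaForm (D x)`**, `D = diag(1, 1, -2)`. [cite: Perutz2006, §2 eq. (2)] -/
theorem hondaFormCLM_eq_betaForm (q : EuclideanSpace ℝ (Fin 4)) :
    hondaFormCLM q = betaForm (Matrix.diagonal ![(1 : ℝ), 1, -2] *ᵥ normalPart q) := by
  ext v
  have hv : v = ![v 0, v 1] := by funext i; fin_cases i <;> rfl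
  rw [hv, hondaFormCLM_apply, betaForm_apply]
  simp [hondaFormA, hondaDQ, hondaBetaVec, Fin.sum_univ_three, Matrix.mulVec_diagonal, normalPart]
  ring

/-! ### Norm bounds -/

/-- Coefficients of a `2`-form on the standard basis are bounded by its norm. [folklore] -/
theorem abs_apply_stdVec_le (α : (EuclideanSpace ℝ (Fin 4)) [⋀^Fin 2]→L[ℝ] ℝ) (i j : Fin 4) :
    |α ![stdVec i, stdVec j]| ≤ ‖α‖ := by
  have h := α.le_opNorm ![stdVec i, stdVec j]
  have h1 : ∏ k : Fin 2, ‖(![stdVec i, stdVec j] : Fin 2 → EuclideanSpace ℝ (Fin 4)) k‖ = 1 := by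
    simp [Fin.prod_univ_two, stdVec, PiLp.norm_single]
  rw [h1, mul_one, Real.norm_eq_abs] at h
  exact h

/-- **`|⟨α, β⟩| ≤ 6 ‖α‖ ‖β‖`** (six products of basis coefficients). [folklore] -/
theorem abs_pfaffianPair_le (α β : (EuclideanSpace ℝ (Fin 4)) [⋀^Fin 2]→L[ℝ] ℝ) :
    |pfaffianPair α β| ≤ 6 * ‖α‖ * ‖β‖ := by
  rw [pfaffianPair_eq]
  have hab : ∀ i j k l : Fin 4, |α ![stdVec i, stdVec j] * β ![stdVec k, stdVec l]| ≤ ‖α‖ * ‖β‖ :=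
    fun i j k l ↦ by
      rw [abs_mul]
      exact mul_le_mul (abs_apply_stdVec_le α i j) (abs_apply_stdVec_le β k l) (abs_nonneg _)
        (norm_nonneg _)
  have hba : ∀ i j k l : Fin 4, |β ![stdVec i, stdVec j] * α ![stdVec k, stdVec l]| ≤ ‖α‖ * ‖β‖ :=
    fun i j k l ↦ by
      rw [abs_mul, mul_comm]
      exact mul_le_mul (abs_apply_stdVec_le α k l) (abs_apply_stdVec_le β i j) (abs_nonneg _)
        (norm_nonneg _)
  have h1 := abs_le.1 (hab 0 1 2 3)
  have h2 := abs_le.1 (hba 0 1 2 3)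
  have h3 := abs_le.1 (hab 0 2 1 3)
  have h4 := abs_le.1 (hba 0 2 1 3)
  have h5 := abs_le.1 (hab 0 3 1 2)
  have h6 := abs_le.1 (hba 0 3 1 2)
  rw [abs_le]
  constructor <;> linarith [h1.1, h1.2, h2.1, h2.2, h3.1, h3.2, h4.1, h4.2, h5.1, h5.2, h6.1, h6.2]

/-- **`|Pf α| ≤ 3 ‖α‖²`.** [folklore] -/
theorem abs_pfaffian_le (α : (EuclideanSpace ℝ (Fin 4)) [⋀^Fin 2]→L[ℝ] ℝ) :
    |pfaffian α| ≤ 3 * ‖α‖ ^ 2 := by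
  have h : 2 * pfaffian α = pfaffianPair α α := (pfaffianPair_self (α := α)).symm
  have h2 := abs_pfaffianPair_le α α
  rw [← h, abs_mul, abs_of_pos (by norm_num : (0 : ℝ) < 2)] at h2
  nlinarith [h2]

/-- **Polarisation**: `Pf(α + β) = Pf α + ⟨α, β⟩ + Pf β`. [folklore] -/
theorem pfaffian_add (α β : (EuclideanSpace ℝ (Fin 4)) [⋀^Fin 2]→L[ℝ] ℝ) :
    pfaffian (α + β) = pfaffian α + pfaffianPair α β + pfaffian β := by
  simp only [pfaffianPair]; ring

/-- **Lower bound for a perturbed Pfaffian**: `Pf(α + β) ≥ Pf α - 6‖α‖‖β‖ - 3‖β‖²`.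
[cite: Perutz2006, §3 (proof of Lemma 3.1)] -/
theorem pfaffian_add_ge (α β : (EuclideanSpace ℝ (Fin 4)) [⋀^Fin 2]→L[ℝ] ℝ) :
    pfaffian α - 6 * ‖α‖ * ‖β‖ - 3 * ‖β‖ ^ 2 ≤ pfaffian (α + β) := by
  rw [pfaffian_add]
  have h1 := abs_pfaffianPair_le α β
  have h2 := abs_pfaffian_le β
  rw [abs_le] at h1 h2
  linarith [h1.1, h2.1]

/-- A perturbed Pfaffian with explicit sizes: if `p ≤ Pf α`, `‖α‖ ≤ a`, `‖β‖ ≤ b` (`0 ≤ a`), then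
`Pf(α + β) ≥ p - 6ab - 3b²`. [folklore] -/
theorem pfaffian_add_ge_of_le {α β : (EuclideanSpace ℝ (Fin 4)) [⋀^Fin 2]→L[ℝ] ℝ} {p a b : ℝ}
    (hp : p ≤ pfaffian α) (ha : ‖α‖ ≤ a) (hb : ‖β‖ ≤ b) :
    p - 6 * a * b - 3 * b ^ 2 ≤ pfaffian (α + β) := by
  have h := pfaffian_add_ge α β
  have hα := norm_nonneg α
  have hβ := norm_nonneg β
  have h1 : ‖α‖ * ‖β‖ ≤ a * b := mul_le_mul ha hb hβ (hα.trans ha)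
  have h2 : ‖β‖ ^ 2 ≤ b ^ 2 := pow_le_pow_left₀ hβ hb 2
  nlinarith

/-- **`‖betaForm a‖ ≤ (‖β₁‖ + ‖β₂‖ + ‖β₃‖) Σ |aₖ|`.** [folklore] -/
theorem norm_betaForm_le (a : Fin 3 → ℝ) :
    ‖betaForm a‖ ≤ (‖hondaBeta₁‖ + ‖hondaBeta₂‖ + ‖hondaBeta₃‖) * ∑ k, |a k| := by
  have h0 : ‖a 0 • hondaBeta₁‖ ≤ ‖hondaBeta₁‖ * |a 0| := by rw [norm_smul, Real.norm_eq_abs, mul_comm]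
  have h1 : ‖a 1 • hondaBeta₂‖ ≤ ‖hondaBeta₂‖ * |a 1| := by rw [norm_smul, Real.norm_eq_abs, mul_comm]
  have h2 : ‖a 2 • hondaBeta₃‖ ≤ ‖hondaBeta₃‖ * |a 2| := by rw [norm_smul, Real.norm_eq_abs, mul_comm]
  have hs : ∑ k, |a k| = |a 0| + |a 1| + |a 2| := by simp [Fin.sum_univ_three]
  rw [hs, betaForm]
  refine (norm_add_le _ _).trans ?_
  refine le_trans (add_le_add (norm_add_le _ _) le_rfl) ?_
  have hn1 := norm_nonneg hondaBeta₁
  have hn2 := norm_nonneg hondaBeta₂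
  have hn3 := norm_nonneg hondaBeta₃
  have ha0 := abs_nonneg (a 0)
  have ha1 := abs_nonneg (a 1)
  have ha2 := abs_nonneg (a 2)
  nlinarith

/-- **`Σ |aₖ| ≤ 3 · max`-type bound: `(Σ |aₖ|)² ≤ 3 Σ aₖ²`.** [folklore] -/
theorem sum_abs_sq_le (a : Fin 3 → ℝ) : (∑ k, |a k|) ^ 2 ≤ 3 * ∑ k, a k ^ 2 := by
  simp only [Fin.sum_univ_three]
  have e0 : |a 0| ^ 2 = a 0 ^ 2 := sq_abs _
  have e1 : |a 1| ^ 2 = a 1 ^ 2 := sq_abs _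
  have e2 : |a 2| ^ 2 = a 2 ^ 2 := sq_abs _
  nlinarith [sq_nonneg (|a 0| - |a 1|), sq_nonneg (|a 1| - |a 2|), sq_nonneg (|a 0| - |a 2|)]

end Literature.Geometry.Symplectic

end
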